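import Mathlib
import HarnessLib
import Summits.NavierStokesRegularity.NavierStokesRegularity.Theorems.TaylorModelRungThreeCertificateFormatVLoop

/-!
# Crux K1b-DR (stmt-NavierStokesRegularity-23954), line `taylor-model` — v3 certificate: chunk replay WITH A PER-SUB-STEP
# PREDICATE on the core output (one forward pass for the chain AND the read-out tube test; successor engine-1 g67)

`StageCtx.checkRange s₀ len` (p624157) replays the sub-steps of a chunk from the chunk's emitted start state and conjoins their
Booleans. The read-outs checker (typer g32, p629733) additionally tests every sub-step's CORE OUTPUT ((R4): `testR4 … (coreVW j s)`);
evaluated separately that would re-run the node recursion `nodeAt s` from node `0` for every `s` (quadratic in `S`). This file adds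
the fused pass: `runFromP P k s N` conjoins `o.ok && P s o.core` along the SAME forward replay, `checkRangeP P s₀ len` starts it from
`startNode s₀`, and `checkRangeP_sound` yields, for every sub-step `s` of the range, both `(subStep s (nodeAt s)).ok = true` (what
`ChecksOK.steps` wants, via `checkRange_sound`'s twin) and `P s (subStep s (nodeAt s)).core = true` (what the read-out composer's
(R4) hypothesis wants, with `P s := testR4 MB (AB j)`). Also `core_subStep_startNode`/`nodeAt_eq_startNode` for reading the LAST
sub-step's node and core output from the emitted checkpoint instead of the recursion. MODEL-lattice bookkeeping only (rung TL-M3);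
nothing here is a statement about the Navier–Stokes equations.
-/

-- the sub-problem namespace repeats the summit name by design (D-0017)
set_option linter.dupNamespace false

namespace Summit.NavierStokesRegularity.NavierStokesRegularity.Theorems.TaylorModelCert

namespace StageCtx

variable (C : StageCtx)

/-- Run `k` sub-steps from sub-step `s` and state `N`, conjoining `o.ok && P s o.core` (chain tests AND a per-sub-step predicate
on the core output, ONE forward pass). [folklore] -/
def runFromP (P : ℕ → CoreOut → Bool) : ℕ → ℕ → NodeSt → Bool
  | 0, _, _ => true
  | k + 1, s, N =>
    let o := C.subStep s N
    (o.ok && P s o.core) && runFromP P k (s + 1) o.next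

/-- **CHUNK CHECK WITH PREDICATE**: the `len` sub-steps starting at `s₀`, from the chunk's start state. [folklore] -/
def checkRangeP (P : ℕ → CoreOut → Bool) (s₀ len : ℕ) : Bool := C.runFromP P len s₀ (C.startNode s₀)

/-- `runFromP` from the true node state certifies every sub-step it runs, with the predicate. [folklore] -/
theorem runFromP_sound (P : ℕ → CoreOut → Bool) : ∀ (k s : ℕ), C.runFromP P k s (C.nodeAt s) = true →
    ∀ i, i < k → (C.subStep (s + i) (C.nodeAt (s + i))).ok = true ∧ P (s + i) (C.subStep (s + i) (C.nodeAt (s + i))).core = true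
  | 0, _, _, i, hi => absurd hi (Nat.not_lt_zero i)
  | k + 1, s, h, i, hi => by
    simp only [runFromP, Bool.and_eq_true] at h
    obtain ⟨⟨h0, hP⟩, hrest⟩ := h
    have hnext : (C.subStep s (C.nodeAt s)).next = C.nodeAt (s + 1) := rfl
    rw [hnext] at hrest
    cases i with
    | zero => exact ⟨by simpa using h0, by simpa using hP⟩
    | succ i =>
      have := runFromP_sound P k (s + 1) hrest i (Nat.lt_of_succ_lt_succ hi)
      simpa only [Nat.add_succ, Nat.succ_add] using this

/-- **Soundness of the chunk check with predicate**: every sub-step of the range passes from the true node state, and its core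
output satisfies the predicate. [folklore] -/
theorem checkRangeP_sound {P : ℕ → CoreOut → Bool} {s₀ len : ℕ} (h : C.checkRangeP P s₀ len = true) {s : ℕ} (hs₀ : s₀ ≤ s)
    (hs : s < s₀ + len) :
    (C.subStep s (C.nodeAt s)).ok = true ∧ P s (C.subStep s (C.nodeAt s)).core = true := by
  unfold checkRangeP at h
  rw [C.startNode_eq_nodeAt] at h
  obtain ⟨i, rfl⟩ := Nat.exists_eq_add_of_le hs₀
  exact C.runFromP_sound P len s₀ h i (by omega)

/-- The chunk check with predicate implies the plain chunk check's conclusion (for `ChecksOK.steps`). [folklore] -/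
theorem ok_of_checkRangeP {P : ℕ → CoreOut → Bool} {s₀ len : ℕ} (h : C.checkRangeP P s₀ len = true) {s : ℕ} (hs₀ : s₀ ≤ s)
    (hs : s < s₀ + len) : (C.subStep s (C.nodeAt s)).ok = true :=
  (C.checkRangeP_sound h hs₀ hs).1

/-- The node of sub-step `s` READ FROM THE CHECKPOINT: `nodeAt s = startNode s` (use the right-hand side in computations — it is the
emitted state when node `s` is a chunk start, instead of the recursion from node `0`). [folklore] -/
theorem nodeAt_eq_startNode (s : ℕ) : C.nodeAt s = C.startNode s := (C.startNode_eq_nodeAt s).symm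

/-- The core output of sub-step `s` computed from the checkpoint equals the one of the recursion. [folklore] -/
theorem core_subStep_startNode (s : ℕ) : (C.subStep s (C.startNode s)).core = (C.subStep s (C.nodeAt s)).core := by
  rw [C.startNode_eq_nodeAt]

/-- The whole sub-step output from the checkpoint equals the one of the recursion. [folklore] -/
theorem subStep_startNode (s : ℕ) : C.subStep s (C.startNode s) = C.subStep s (C.nodeAt s) := by
  rw [C.startNode_eq_nodeAt]

end StageCtx

end Summit.NavierStokesRegularity.NavierStokesRegularity.Theorems.TaylorModelCert
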